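import Summits.QuantumFields.YangMills.Theorems.BalabanUVNodesN15KingModelPotentialDressedMinimiser

/-!
# BalabanUVNodes ∕ N15 — THE KING MODEL, PART 11c: THE DRESSED MINIMISER DECAYS — `|ℋ_w(x, b)| ≤ 2c_H·e^{−δ|B(x) − b|}` by a WEIGHTED ℓ^∞
# Neumann step on the resolvent fixed point; its two-spacing bound WITH decay; and the two-spacing difference of the FULL perturbation
# `E(w) = Δ_w − Δ` WITH DECAY IN THE UNIT SITES (King's Theorem 3.3 (3.7) ∕ Prop. 3.8 (3.71) shapes for the dressed objects)
# (Track A, DAG node N15 = NE2; FAN-OUT v1.1 §N15 s3 «KING-MODEL RUNG»)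

HONEST FRAMING.  Count-neutral kernel bookkeeping (cell `pub-ymgap`, seat `pub-ymgap-dag-n15-d` g8; `--supports stmt-QuantumFields-20292
--as helper` = K3⁗ `SpineGivenEndpointR13Sep`; lineage K3 19676 → K3′ 19908 → K3‴ 19912).  King's `A = 0` SCALAR block-spin tower ([King1986]
§2.2 (2.13)–(2.15) p. 653, §4 (4.5) p. 670) dressed by a fine-lattice POTENTIAL `w` (a multiplication operator: part 8d `fineOpPot` ∕ `effLaplacianPot`,
part 10b `kingHPot`); NOT a gauge field; nothing here is Bałaban's `H_k(U)` ∕ `Δ^{(k)}(U) − Δ^{(k)}(1)`; NOT a node discharge; nothing continuum ∕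
ℝ⁴ ∕ OS ∕ mass-gap ∕ Clay.  0 `sorry`, 0 `def`, standard axioms.
THE POINT.  Part 10b bounded the dressed minimiser `ℋ_w` and its two-spacing step in SUP norm (10b HONEST SCOPE (ii): no decay); hence part 10c's
(H3) letter of the full perturbation had no decay in the unit sites, unlike part 8b's first-order letter.  With the WEIGHTED Riemann bounds of parts
11a∕11b (`Σ_y N^{−(d+1)}|G(x, y)|e^{+δ′|B x − B y|} ≤ C_W`, and the weighted two-spacing rate `R_W`), the ℓ^∞ Neumann steps of 10b run in the
weighted sup norm `f(x) = |·|·e^{δ′|B(x) − b|}` (triangle inequality `|B x − b| ≤ |B x − B y| + |B y − b|`), giving DECAY: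
* §1 `exp_weight_split`, ★★ **`kingHPot_decay`** — `|ℋ_w(x, b)| ≤ 2c_H·e^{−δ′|B(x) − b|}` whenever
  `|ℋ(x, b)| ≤ c_H·e^{−δ′|B(x) − b|}` (Theorem 3.3), the weighted mass is `≤ C_W`, `|w| ≤ w₀`, `C_W·w₀ ≤ 1∕2`;
* §2 `weighted_kernel3_bound` (the weighted telescoping, pure real arithmetic), ★★ **`kingHPot_step_decay`** — `|ℋ′_{w′}(x′, b) − ℋ_w(x, b)| ≤ 2(D₀ + R_W·w₀H′ + C_W·νH′)·e^{−δ′|B(x′) − b|}` from the DECAYING undressed step `D₀`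
  (Prop. 3.8 line 1), the weighted rate `R_W`, the weighted mass `C_W`, coherence `ν` and the weighted dressed size `H′` of §1;
* §3 ★★ **`effLaplacianPot_sub_step_decay`** — `|E′(w′)(b, b′) − E(w)(b, b′)| ≤ K_{d+1}(δ′∕2)·(D₁w₀H′ + c_H(νH′ + w₀S_d))·e^{−(δ′∕2)|b − b′|}` (both legs
  decay: the `b`-leg by ℋ ∕ its step, the `b′`-leg by §1 ∕ §2; one two-centre block sum, part 8a `sum_exp_two_centre_le`).
All letters are numerical hypotheses (as in 10b); part 11d discharges them along King's run (parts 8b, 9a∕9c, 11a∕11b).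
HONEST SCOPE.  (i) §1 on any unit torus and fine count; §2–§3 in the two-run format `L^k`, `L·L^k` of parts 8a–8c; (ii) decay in the BLOCK distance
`|B(x) − b|_U` (King's (3.7) currency); (iii) scalar potential, `A = 0`; (iv) elementary consequences of the second resolvent identity, not printed
propositions of [King1986]; not a discharge.
Locators: [King1986] C. King, CMP **102** (1986) 649–677: (2.13)–(2.15) p. 653, Theorem 3.3 (3.7) p. 658 (PDF: p. 655, (3.7) p. 656), Prop. 3.8
(3.71) p. 664 and p. 664 (pairing), (4.39)–(4.41) p. 675; [B9] = [Balaban1985BackgroundPropagators] (3.35)–(3.36) p. 396 (slots: typing template).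
-/

noncomputable section

open scoped BigOperators Matrix
open Finset

namespace Summit.QuantumFields.YangMills.BalabanUVNodes.N15.KingModel

open Literature.MathematicalPhysics.QuantumFieldTheory.Balaban1983to89 hiding blockOf
open Literature.MathematicalPhysics.QuantumFieldTheory.Balaban1983to89.B4Sect5Proof (latticeConst latticeConst_nonneg)
open Literature.MathematicalPhysics.QuantumFieldTheory.Balaban1983to89.B5Prop11Plancherel (Tor fine)
open Literature.MathematicalPhysics.QuantumFieldTheory.King1986 (aK aK_pos)
open Literature.MathematicalPhysics.QuantumFieldTheory.King1986.Torus
open Summit.QuantumFields.YangMills.BalabanUVNodes.N15KingModelRung (kingH)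
open Summit.QuantumFields.YangMills.BalabanUVNodes.N15KingModelRung.Curved (underPtN val_underPtN blockOf_underPtN)

variable {d : ℕ}

/-! ## §1 The weighted Neumann step and the decay of the dressed minimiser -/

section Decay

variable {L : ℕ} {Nf : ℕ} [NeZero Nf] {U : Fin (d + 1) → ℕ} [∀ μ, NeZero (U μ)] {a m2 : ℝ}

/-- The exponential weight splits along the triangle inequality of the block distance: `e^{δ|z − b|} ≤ e^{δ|z − z′|}·e^{δ|z′ − b|}` (`δ ≥ 0`). [folklore] -/
theorem exp_weight_split {δ : ℝ} (hδ : 0 ≤ δ) (z z' b : Tor U) :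
    Real.exp (δ * tdistT U z b) ≤ Real.exp (δ * tdistT U z z') * Real.exp (δ * tdistT U z' b) := by
  rw [← Real.exp_add]
  exact Real.exp_le_exp.mpr (by nlinarith [(tdistT_isPseudoDist U).triangle z z' b])

/-- **THE DECAY OF THE DRESSED MINIMISER** (King's Theorem 3.3 (3.7) shape for `ℋ_w`): if `|ℋ(x, b)| ≤ c_H·e^{−δ′|B(x) − b|}`, the WEIGHTED Riemann mass of
`G` at rate `δ′` is `≤ C_W` (part 11a), `|w| ≤ w₀` and `C_W·w₀ ≤ 1∕2`, then `|ℋ_w(x, b)| ≤ 2c_H·e^{−δ′|B(x) − b|}` for all `x, b` — the ℓ^∞ Neumann step of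
part 10b in the weighted sup norm `|ℋ_w(·, b)|·e^{δ′|B(·) − b|}`. [cite: King1986, (2.15) p.653, Theorem 3.3 (3.7) p.658] -/
theorem kingHPot_decay {k : ℕ} (hak : 0 ≤ aK a L k) (hm : 0 < m2) {w : Tor (fine Nf U) → ℝ}
    (hB : IsUnit (fineOpPot Nf U (aK a L k) (((Nf : ℕ) : ℝ) ^ 2) m2 w)) {cH CW w₀ δ' : ℝ} (hcH : 0 ≤ cH) (hδ' : 0 ≤ δ')
    (hH : ∀ (b : Tor U) (x : Tor (fine Nf U)), |kingH L Nf U a m2 k b x| ≤ cH * Real.exp (-(δ' * tdistT U (blockOf Nf U x) b)))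
    (hmassW : ∀ x : Tor (fine Nf U), (((Nf : ℕ) : ℝ) ^ (d + 1))⁻¹ *
      ∑ y, |constrainedProp Nf U (aK a L k) (((Nf : ℕ) : ℝ) ^ 2) m2 x y| * Real.exp (δ' * tdistT U (blockOf Nf U x) (blockOf Nf U y)) ≤ CW)
    (hw : ∀ y, |w y| ≤ w₀) (hwin : CW * w₀ ≤ 1 / 2) (b : Tor U) (x : Tor (fine Nf U)) :
    |kingHPot L Nf U a m2 k w b x| ≤ 2 * cH * Real.exp (-(δ' * tdistT U (blockOf Nf U x) b)) := by
  have hw₀ := nonneg_of_abs_le hw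
  have hNpos : (0 : ℝ) < ((Nf : ℕ) : ℝ) ^ (d + 1) := pow_pos (Nat.cast_pos.mpr (Nat.pos_of_ne_zero (NeZero.ne Nf))) _
  -- the weighted sup norm `f(y) = |ℋ_w(y, b)|·e^{δ′|B y − b|}`
  set f : Tor (fine Nf U) → ℝ := fun y => |kingHPot L Nf U a m2 k w b y| * Real.exp (δ' * tdistT U (blockOf Nf U y) b) with hfdef
  have hf : f x ≤ 2 * cH := by
    refine sup_bound_of_affine f hcH hwin (fun S hS z => ?_) x
    have hS0 : 0 ≤ S := le_trans (by rw [hfdef]; positivity) (hS z)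
    set ez : ℝ := Real.exp (δ' * tdistT U (blockOf Nf U z) b) with hez
    have hez0 : 0 < ez := Real.exp_pos _
    -- the fixed point, multiplied by the weight
    have hfix := kingHPot_fixedPoint (L := L) hak hm hB b z
    have hterm : ∀ y, |constrainedProp Nf U (aK a L k) (((Nf : ℕ) : ℝ) ^ 2) m2 z y * w y * kingHPot L Nf U a m2 k w b y| * ez
        ≤ |constrainedProp Nf U (aK a L k) (((Nf : ℕ) : ℝ) ^ 2) m2 z y| * Real.exp (δ' * tdistT U (blockOf Nf U z) (blockOf Nf U y))
          * (w₀ * S) := by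
      intro y
      have hsplit := exp_weight_split hδ' (blockOf Nf U z) (blockOf Nf U y) b
      have hfy : |kingHPot L Nf U a m2 k w b y| * Real.exp (δ' * tdistT U (blockOf Nf U y) b) ≤ S := hS y
      rw [abs_mul, abs_mul]
      calc |constrainedProp Nf U (aK a L k) (((Nf : ℕ) : ℝ) ^ 2) m2 z y| * |w y| * |kingHPot L Nf U a m2 k w b y| * ez
          ≤ |constrainedProp Nf U (aK a L k) (((Nf : ℕ) : ℝ) ^ 2) m2 z y| * w₀ *
              (|kingHPot L Nf U a m2 k w b y| * (Real.exp (δ' * tdistT U (blockOf Nf U z) (blockOf Nf U y))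
                * Real.exp (δ' * tdistT U (blockOf Nf U y) b))) := by
            rw [hez]
            have h1 : |constrainedProp Nf U (aK a L k) (((Nf : ℕ) : ℝ) ^ 2) m2 z y| * |w y|
                ≤ |constrainedProp Nf U (aK a L k) (((Nf : ℕ) : ℝ) ^ 2) m2 z y| * w₀ :=
              mul_le_mul_of_nonneg_left (hw y) (abs_nonneg _)
            calc _ = (|constrainedProp Nf U (aK a L k) (((Nf : ℕ) : ℝ) ^ 2) m2 z y| * |w y|)
                  * (|kingHPot L Nf U a m2 k w b y| * Real.exp (δ' * tdistT U (blockOf Nf U z) b)) := by ring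
              _ ≤ (|constrainedProp Nf U (aK a L k) (((Nf : ℕ) : ℝ) ^ 2) m2 z y| * w₀)
                  * (|kingHPot L Nf U a m2 k w b y| * (Real.exp (δ' * tdistT U (blockOf Nf U z) (blockOf Nf U y))
                    * Real.exp (δ' * tdistT U (blockOf Nf U y) b))) :=
                  mul_le_mul h1 (mul_le_mul_of_nonneg_left hsplit (abs_nonneg _)) (by positivity) (by positivity)
              _ = _ := by ring
        _ = |constrainedProp Nf U (aK a L k) (((Nf : ℕ) : ℝ) ^ 2) m2 z y| * Real.exp (δ' * tdistT U (blockOf Nf U z) (blockOf Nf U y))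
              * (w₀ * (|kingHPot L Nf U a m2 k w b y| * Real.exp (δ' * tdistT U (blockOf Nf U y) b))) := by ring
        _ ≤ _ := mul_le_mul_of_nonneg_left (mul_le_mul_of_nonneg_left hfy hw₀) (by positivity)
    show |kingHPot L Nf U a m2 k w b z| * ez ≤ cH + CW * w₀ * S
    rw [hfix]
    calc |kingH L Nf U a m2 k b z - (((Nf : ℕ) : ℝ) ^ (d + 1))⁻¹ *
            ∑ y, constrainedProp Nf U (aK a L k) (((Nf : ℕ) : ℝ) ^ 2) m2 z y * w y * kingHPot L Nf U a m2 k w b y| * ez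
        ≤ (|kingH L Nf U a m2 k b z| + (((Nf : ℕ) : ℝ) ^ (d + 1))⁻¹ *
            ∑ y, |constrainedProp Nf U (aK a L k) (((Nf : ℕ) : ℝ) ^ 2) m2 z y * w y * kingHPot L Nf U a m2 k w b y|) * ez := by
          refine mul_le_mul_of_nonneg_right ((abs_sub _ _).trans (add_le_add le_rfl ?_)) hez0.le
          rw [abs_mul, abs_of_pos (inv_pos.mpr hNpos)]
          exact mul_le_mul_of_nonneg_left (abs_sum_le_sum_abs _ _) (inv_nonneg.mpr hNpos.le)
      _ = |kingH L Nf U a m2 k b z| * ez + (((Nf : ℕ) : ℝ) ^ (d + 1))⁻¹ *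
            ∑ y, |constrainedProp Nf U (aK a L k) (((Nf : ℕ) : ℝ) ^ 2) m2 z y * w y * kingHPot L Nf U a m2 k w b y| * ez := by
          rw [add_mul, mul_assoc, sum_mul]
      _ ≤ cH + (((Nf : ℕ) : ℝ) ^ (d + 1))⁻¹ *
            ∑ y, |constrainedProp Nf U (aK a L k) (((Nf : ℕ) : ℝ) ^ 2) m2 z y| * Real.exp (δ' * tdistT U (blockOf Nf U z) (blockOf Nf U y))
              * (w₀ * S) := by
          refine add_le_add ?_ (mul_le_mul_of_nonneg_left (sum_le_sum fun y _ => hterm y) (inv_nonneg.mpr hNpos.le))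
          calc |kingH L Nf U a m2 k b z| * ez ≤ cH * Real.exp (-(δ' * tdistT U (blockOf Nf U z) b)) * ez :=
                mul_le_mul_of_nonneg_right (hH b z) hez0.le
            _ = cH := by rw [hez, mul_assoc, ← Real.exp_add, neg_add_cancel, Real.exp_zero, mul_one]
      _ = cH + (((Nf : ℕ) : ℝ) ^ (d + 1))⁻¹ *
            (∑ y, |constrainedProp Nf U (aK a L k) (((Nf : ℕ) : ℝ) ^ 2) m2 z y| * Real.exp (δ' * tdistT U (blockOf Nf U z) (blockOf Nf U y)))
              * (w₀ * S) := by rw [← sum_mul, mul_assoc]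
      _ ≤ cH + CW * (w₀ * S) := by
          have := mul_le_mul_of_nonneg_right (hmassW z) (mul_nonneg hw₀ hS0)
          linarith
      _ = cH + CW * w₀ * S := by ring
  -- unweight
  have hex : 0 < Real.exp (δ' * tdistT U (blockOf Nf U x) b) := Real.exp_pos _
  have hf' : |kingHPot L Nf U a m2 k w b x| * Real.exp (δ' * tdistT U (blockOf Nf U x) b) ≤ 2 * cH := hf
  calc |kingHPot L Nf U a m2 k w b x|
      = |kingHPot L Nf U a m2 k w b x| * Real.exp (δ' * tdistT U (blockOf Nf U x) b) * Real.exp (-(δ' * tdistT U (blockOf Nf U x) b)) := by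
        rw [mul_assoc, ← Real.exp_add, add_neg_cancel, Real.exp_zero, mul_one]
    _ ≤ 2 * cH * Real.exp (-(δ' * tdistT U (blockOf Nf U x) b)) := mul_le_mul_of_nonneg_right hf' (Real.exp_pos _).le

end Decay

/-! ## §2 The two-spacing bound of the dressed minimiser WITH decay -/

section StepDecay

/-- The weighted three-factor telescoping bound behind §2 (pure real arithmetic): with weights `w_z ≤ e_z·w_y`, sizes `|w′|, |w| ≤ w₀`, coherence
`|w′ − w| ≤ ν`, weighted dressed size `|h′|·w_y ≤ H′` and weighted dressed step `|h′ − h|·w_y ≤ S`,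
`|G′w′h′ − Gwh|·w_z ≤ |G′ − G|·e_z·(w₀H′) + |G|·e_z·(νH′ + w₀S)`. [folklore] -/
theorem weighted_kernel3_bound {G G' w w' h h' wz ez wy w₀ H' ν S : ℝ} (hwz : 0 ≤ wz) (hez : 0 ≤ ez) (hwy : 0 ≤ wy)
    (hw₀ : 0 ≤ w₀) (hν : 0 ≤ ν) (h1 : |w'| ≤ w₀) (h2 : |w| ≤ w₀) (h3 : |w' - w| ≤ ν) (h4 : |h'| * wy ≤ H')
    (h5 : |h' - h| * wy ≤ S) (h6 : wz ≤ ez * wy) :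
    |G' * w' * h' - G * w * h| * wz ≤ |G' - G| * ez * (w₀ * H') + |G| * ez * (ν * H' + w₀ * S) := by
  have htel := abs_kernel3_sub_le G G' w w' h h'
  have hH' : 0 ≤ H' := le_trans (by positivity) h4
  have hS : 0 ≤ S := le_trans (by positivity) h5
  calc |G' * w' * h' - G * w * h| * wz
      ≤ (|G' - G| * |w'| * |h'| + |G| * (|w' - w| * |h'| + |w| * |h' - h|)) * (ez * wy) :=
        mul_le_mul htel h6 hwz (by positivity)
    _ = |G' - G| * ez * (|w'| * (|h'| * wy)) + |G| * ez * (|w' - w| * (|h'| * wy) + |w| * (|h' - h| * wy)) := by ring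
    _ ≤ |G' - G| * ez * (w₀ * H') + |G| * ez * (ν * H' + w₀ * S) := by
        have a1 : |w'| * (|h'| * wy) ≤ w₀ * H' := mul_le_mul h1 h4 (by positivity) hw₀
        have a2 : |w' - w| * (|h'| * wy) ≤ ν * H' := mul_le_mul h3 h4 (by positivity) hν
        have a3 : |w| * (|h' - h| * wy) ≤ w₀ * S := mul_le_mul h2 h5 (by positivity) hw₀
        have b1 : 0 ≤ |G' - G| * ez := by positivity
        have b2 : 0 ≤ |G| * ez := by positivity
        nlinarith [mul_le_mul_of_nonneg_left a1 b1, mul_le_mul_of_nonneg_left (add_le_add a2 a3) b2]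


variable (L : ℕ) [NeZero L] {U : Fin (d + 1) → ℕ} [∀ μ, NeZero (U μ)] {a m2 : ℝ}

/-- **THE TWO-SPACING BOUND OF THE DRESSED MINIMISER WITH DECAY** (Prop. 3.8 (3.71) line 1 shape for `ℋ_w`).  Two runs `L^k`, `L·L^k` over `U`,
potentials `w, w′` with the dressed operators invertible; DECAYING letters at a common rate `δ′ ≥ 0`: `|ℋ′(x′, b) − ℋ(x, b)| ≤ D₀·e^{−δ′|B(x′) − b|}`,
weighted mass `≤ C_W` (coarse run), weighted two-spacing rate `≤ R_W` of the propagators (part 11b), `|w|, |w′| ≤ w₀`, coherence `ν`, `C_W·w₀ ≤ 1∕2`,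
weighted dressed size `|ℋ′_{w′}(y′, b)| ≤ H′·e^{−δ′|B(y′) − b|}`.  Then `|ℋ′_{w′}(x′, b) − ℋ_w(x, b)| ≤ 2(D₀ + R_W(w₀H′) + C_W(νH′))·e^{−δ′|B(x′) − b|}`.
[cite: King1986, (2.15) p.653, Theorem 3.3 (3.7) p.658, Prop. 3.8 (3.71) p.664, p.664 (pairing)] -/
theorem kingHPot_step_decay {k : ℕ} (hak : 0 ≤ aK a L k) (hak' : 0 ≤ aK a L (k + 1)) (hm : 0 < m2)
    {w : Tor (fine (L ^ k) U) → ℝ} {w' : Tor (fine (L ^ 1 * L ^ k) U) → ℝ}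
    (hB : IsUnit (fineOpPot (L ^ k) U (aK a L k) (((L ^ k : ℕ) : ℝ) ^ 2) m2 w))
    (hB' : IsUnit (fineOpPot (L ^ 1 * L ^ k) U (aK a L (k + 1)) (((L ^ 1 * L ^ k : ℕ) : ℝ) ^ 2) m2 w'))
    {D0 CW RW w₀ ν H' δ' : ℝ} (hD0 : 0 ≤ D0) (hCW : 0 ≤ CW) (hRW : 0 ≤ RW) (hH'0 : 0 ≤ H') (hδ' : 0 ≤ δ')
    (hstep0 : ∀ (b : Tor U) (x' : Tor (fine (L ^ 1 * L ^ k) U)),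
      |kingH L (L ^ 1 * L ^ k) U a m2 (k + 1) b x' - kingH L (L ^ k) U a m2 k b (underPtN L k 1 U x')|
        ≤ D0 * Real.exp (-(δ' * tdistT U (blockOf (L ^ 1 * L ^ k) U x') b)))
    (hmassW : ∀ x : Tor (fine (L ^ k) U), (((L ^ k : ℕ) : ℝ) ^ (d + 1))⁻¹ *
      ∑ y, |constrainedProp (L ^ k) U (aK a L k) (((L ^ k : ℕ) : ℝ) ^ 2) m2 x y|
        * Real.exp (δ' * tdistT U (blockOf (L ^ k) U x) (blockOf (L ^ k) U y)) ≤ CW)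
    (hrateW : ∀ x' : Tor (fine (L ^ 1 * L ^ k) U), (((L ^ 1 * L ^ k : ℕ) : ℝ) ^ (d + 1))⁻¹ *
      ∑ y', |constrainedProp (L ^ 1 * L ^ k) U (aK a L (k + 1)) (((L ^ 1 * L ^ k : ℕ) : ℝ) ^ 2) m2 x' y'
          - constrainedProp (L ^ k) U (aK a L k) (((L ^ k : ℕ) : ℝ) ^ 2) m2 (underPtN L k 1 U x') (underPtN L k 1 U y')|
        * Real.exp (δ' * tdistT U (blockOf (L ^ k) U (underPtN L k 1 U x')) (blockOf (L ^ k) U (underPtN L k 1 U y'))) ≤ RW)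
    (hw : ∀ y, |w y| ≤ w₀) (hw' : ∀ y', |w' y'| ≤ w₀) (hcoh : ∀ y', |w' y' - w (underPtN L k 1 U y')| ≤ ν)
    (hwin : CW * w₀ ≤ 1 / 2)
    (hH' : ∀ (b : Tor U) (y' : Tor (fine (L ^ 1 * L ^ k) U)),
      |kingHPot L (L ^ 1 * L ^ k) U a m2 (k + 1) w' b y'| ≤ H' * Real.exp (-(δ' * tdistT U (blockOf (L ^ 1 * L ^ k) U y') b)))
    (b : Tor U) (x' : Tor (fine (L ^ 1 * L ^ k) U)) :
    |kingHPot L (L ^ 1 * L ^ k) U a m2 (k + 1) w' b x' - kingHPot L (L ^ k) U a m2 k w b (underPtN L k 1 U x')|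
      ≤ 2 * (D0 + RW * (w₀ * H') + CW * (ν * H')) * Real.exp (-(δ' * tdistT U (blockOf (L ^ 1 * L ^ k) U x') b)) := by
  have hw₀ : 0 ≤ w₀ := nonneg_of_abs_le hw
  have hν : 0 ≤ ν := (abs_nonneg _).trans (hcoh fun _ => 0)
  have hN'pos : (0 : ℝ) < (((L ^ 1 * L ^ k : ℕ) : ℝ)) ^ (d + 1) :=
    pow_pos (Nat.cast_pos.mpr (Nat.pos_of_ne_zero (NeZero.ne _))) _
  set G := constrainedProp (L ^ k) U (aK a L k) (((L ^ k : ℕ) : ℝ) ^ 2) m2 with hGdef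
  set G' := constrainedProp (L ^ 1 * L ^ k) U (aK a L (k + 1)) (((L ^ 1 * L ^ k : ℕ) : ℝ) ^ 2) m2 with hG'def
  -- weight at a fine point of the finer run: `e(y′) = e^{δ′|B(y′) − b|}` (`B(y′) = B(y)`, `y` under `y′`)
  set wt : Tor (fine (L ^ 1 * L ^ k) U) → ℝ := fun y' => Real.exp (δ' * tdistT U (blockOf (L ^ 1 * L ^ k) U y') b) with hwtdef
  have hwt0 : ∀ y', 0 < wt y' := fun y' => Real.exp_pos _
  set f : Tor (fine (L ^ 1 * L ^ k) U) → ℝ := fun y' =>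
    |kingHPot L (L ^ 1 * L ^ k) U a m2 (k + 1) w' b y' - kingHPot L (L ^ k) U a m2 k w b (underPtN L k 1 U y')| * wt y' with hfdef
  have hf : f x' ≤ 2 * (D0 + RW * (w₀ * H') + CW * (ν * H')) := by
    refine sup_bound_of_affine f (by positivity) hwin (fun S hS z' => ?_) x'
    have hS0 : 0 ≤ S := le_trans (by rw [hfdef]; positivity) (hS z')
    set z := underPtN L k 1 U z' with hzdef
    have hBz : blockOf (L ^ k) U z = blockOf (L ^ 1 * L ^ k) U z' := by rw [hzdef, blockOf_underPtN]
    -- the two fixed points and the coarse Riemann sum moved to the finer lattice (as in part 10b)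
    have hfine := kingHPot_fixedPoint (L := L) (Nf := L ^ 1 * L ^ k) (U := U) (a := a) (m2 := m2) hak' hm hB' b z'
    have hcoarse := kingHPot_fixedPoint (L := L) (Nf := L ^ k) (U := U) (a := a) (m2 := m2) hak hm hB b z
    have hmove : (((L ^ k : ℕ) : ℝ) ^ (d + 1))⁻¹ * ∑ y, G z y * w y * kingHPot L (L ^ k) U a m2 k w b y
        = (((L ^ 1 * L ^ k : ℕ) : ℝ) ^ (d + 1))⁻¹ *
          ∑ y', G z (underPtN L k 1 U y') * w (underPtN L k 1 U y') * kingHPot L (L ^ k) U a m2 k w b (underPtN L k 1 U y') :=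
      (avg_comp_underPtN L U k (fun y => G z y * w y * kingHPot L (L ^ k) U a m2 k w b y)).symm
    have hmoveW : (((L ^ 1 * L ^ k : ℕ) : ℝ) ^ (d + 1))⁻¹ *
          ∑ y', |G z (underPtN L k 1 U y')| * Real.exp (δ' * tdistT U (blockOf (L ^ k) U z) (blockOf (L ^ k) U (underPtN L k 1 U y')))
        = (((L ^ k : ℕ) : ℝ) ^ (d + 1))⁻¹ * ∑ y, |G z y| * Real.exp (δ' * tdistT U (blockOf (L ^ k) U z) (blockOf (L ^ k) U y)) :=
      avg_comp_underPtN L U k (fun y => |G z y| * Real.exp (δ' * tdistT U (blockOf (L ^ k) U z) (blockOf (L ^ k) U y)))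
    have hdiff : kingHPot L (L ^ 1 * L ^ k) U a m2 (k + 1) w' b z' - kingHPot L (L ^ k) U a m2 k w b z
        = (kingH L (L ^ 1 * L ^ k) U a m2 (k + 1) b z' - kingH L (L ^ k) U a m2 k b z)
          - (((L ^ 1 * L ^ k : ℕ) : ℝ) ^ (d + 1))⁻¹ *
            ∑ y', (G' z' y' * w' y' * kingHPot L (L ^ 1 * L ^ k) U a m2 (k + 1) w' b y'
              - G z (underPtN L k 1 U y') * w (underPtN L k 1 U y') * kingHPot L (L ^ k) U a m2 k w b (underPtN L k 1 U y')) := by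
      rw [hfine, hcoarse, hmove, sum_sub_distrib, mul_sub]
      ring
    -- termwise telescoping with the weight split along `|B z′ − b| ≤ |B z′ − B y′| + |B y′ − b|`
    have hterm : ∀ y', |G' z' y' * w' y' * kingHPot L (L ^ 1 * L ^ k) U a m2 (k + 1) w' b y'
          - G z (underPtN L k 1 U y') * w (underPtN L k 1 U y') * kingHPot L (L ^ k) U a m2 k w b (underPtN L k 1 U y')| * wt z'
        ≤ (|G' z' y' - G z (underPtN L k 1 U y')|
              * Real.exp (δ' * tdistT U (blockOf (L ^ k) U z) (blockOf (L ^ k) U (underPtN L k 1 U y')))) * (w₀ * H')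
          + (|G z (underPtN L k 1 U y')| * Real.exp (δ' * tdistT U (blockOf (L ^ k) U z) (blockOf (L ^ k) U (underPtN L k 1 U y'))))
              * (ν * H' + w₀ * S) := by
      intro y'
      have hsplit : wt z' ≤ Real.exp (δ' * tdistT U (blockOf (L ^ k) U z) (blockOf (L ^ k) U (underPtN L k 1 U y'))) * wt y' := by
        rw [hwtdef, blockOf_underPtN L k 1 U y']
        dsimp only
        rw [← hBz]
        exact exp_weight_split hδ' (blockOf (L ^ k) U z) (blockOf (L ^ 1 * L ^ k) U y') b
      have hH'y : |kingHPot L (L ^ 1 * L ^ k) U a m2 (k + 1) w' b y'| * wt y' ≤ H' := by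
        calc |kingHPot L (L ^ 1 * L ^ k) U a m2 (k + 1) w' b y'| * wt y'
            ≤ H' * Real.exp (-(δ' * tdistT U (blockOf (L ^ 1 * L ^ k) U y') b)) * wt y' :=
              mul_le_mul_of_nonneg_right (hH' b y') (hwt0 y').le
          _ = H' := by rw [hwtdef]; dsimp only; rw [mul_assoc, ← Real.exp_add, neg_add_cancel, Real.exp_zero, mul_one]
      exact weighted_kernel3_bound (hwt0 z').le (Real.exp_pos _).le (hwt0 y').le hw₀ hν (hw' y') (hw _) (hcoh y') hH'y (hS y') hsplit
    have hsum : (((L ^ 1 * L ^ k : ℕ) : ℝ) ^ (d + 1))⁻¹ *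
        ∑ y', |G' z' y' * w' y' * kingHPot L (L ^ 1 * L ^ k) U a m2 (k + 1) w' b y'
          - G z (underPtN L k 1 U y') * w (underPtN L k 1 U y') * kingHPot L (L ^ k) U a m2 k w b (underPtN L k 1 U y')| * wt z'
      ≤ RW * (w₀ * H') + CW * (ν * H' + w₀ * S) := by
      calc _ ≤ (((L ^ 1 * L ^ k : ℕ) : ℝ) ^ (d + 1))⁻¹ *
          ∑ y', ((|G' z' y' - G z (underPtN L k 1 U y')|
              * Real.exp (δ' * tdistT U (blockOf (L ^ k) U z) (blockOf (L ^ k) U (underPtN L k 1 U y')))) * (w₀ * H')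
            + (|G z (underPtN L k 1 U y')| * Real.exp (δ' * tdistT U (blockOf (L ^ k) U z) (blockOf (L ^ k) U (underPtN L k 1 U y'))))
              * (ν * H' + w₀ * S)) :=
          mul_le_mul_of_nonneg_left (sum_le_sum fun y' _ => hterm y') (inv_nonneg.mpr hN'pos.le)
      _ = (((L ^ 1 * L ^ k : ℕ) : ℝ) ^ (d + 1))⁻¹ * (∑ y', |G' z' y' - G z (underPtN L k 1 U y')|
              * Real.exp (δ' * tdistT U (blockOf (L ^ k) U z) (blockOf (L ^ k) U (underPtN L k 1 U y')))) * (w₀ * H')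
          + (((L ^ 1 * L ^ k : ℕ) : ℝ) ^ (d + 1))⁻¹ * (∑ y', |G z (underPtN L k 1 U y')|
              * Real.exp (δ' * tdistT U (blockOf (L ^ k) U z) (blockOf (L ^ k) U (underPtN L k 1 U y')))) * (ν * H' + w₀ * S) := by
          rw [sum_add_distrib, ← sum_mul, ← sum_mul]
          ring
      _ ≤ RW * (w₀ * H') + CW * (ν * H' + w₀ * S) := by
          have h1 := hrateW z'
          have h2 : (((L ^ 1 * L ^ k : ℕ) : ℝ) ^ (d + 1))⁻¹ * ∑ y', |G z (underPtN L k 1 U y')|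
              * Real.exp (δ' * tdistT U (blockOf (L ^ k) U z) (blockOf (L ^ k) U (underPtN L k 1 U y'))) ≤ CW := by
            rw [hmoveW]; exact hmassW z
          have hνS : 0 ≤ ν * H' + w₀ * S := by positivity
          exact add_le_add (mul_le_mul_of_nonneg_right h1 (by positivity)) (mul_le_mul_of_nonneg_right h2 hνS)
    show |kingHPot L (L ^ 1 * L ^ k) U a m2 (k + 1) w' b z' - kingHPot L (L ^ k) U a m2 k w b (underPtN L k 1 U z')| * wt z'
        ≤ D0 + RW * (w₀ * H') + CW * (ν * H') + CW * w₀ * S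
    rw [← hzdef, hdiff]
    calc _ ≤ (|kingH L (L ^ 1 * L ^ k) U a m2 (k + 1) b z' - kingH L (L ^ k) U a m2 k b z|
          + |(((L ^ 1 * L ^ k : ℕ) : ℝ) ^ (d + 1))⁻¹ *
            ∑ y', (G' z' y' * w' y' * kingHPot L (L ^ 1 * L ^ k) U a m2 (k + 1) w' b y'
              - G z (underPtN L k 1 U y') * w (underPtN L k 1 U y') * kingHPot L (L ^ k) U a m2 k w b (underPtN L k 1 U y'))|) * wt z' :=
        mul_le_mul_of_nonneg_right (abs_sub _ _) (hwt0 z').le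
      _ ≤ D0 + (RW * (w₀ * H') + CW * (ν * H' + w₀ * S)) := by
        rw [add_mul]
        refine add_le_add ?_ ?_
        · calc |kingH L (L ^ 1 * L ^ k) U a m2 (k + 1) b z' - kingH L (L ^ k) U a m2 k b z| * wt z'
              ≤ D0 * Real.exp (-(δ' * tdistT U (blockOf (L ^ 1 * L ^ k) U z') b)) * wt z' :=
                mul_le_mul_of_nonneg_right (by rw [hzdef]; exact hstep0 b z') (hwt0 z').le
            _ = D0 := by rw [hwtdef]; dsimp only; rw [mul_assoc, ← Real.exp_add, neg_add_cancel, Real.exp_zero, mul_one]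
        · rw [abs_mul, abs_of_pos (inv_pos.mpr hN'pos), mul_assoc]
          refine le_trans (mul_le_mul_of_nonneg_left (mul_le_mul_of_nonneg_right (abs_sum_le_sum_abs _ _) (hwt0 z').le)
            (inv_nonneg.mpr hN'pos.le)) ?_
          rw [sum_mul]
          exact hsum
      _ = D0 + RW * (w₀ * H') + CW * (ν * H') + CW * w₀ * S := by ring
  -- unweight
  calc |kingHPot L (L ^ 1 * L ^ k) U a m2 (k + 1) w' b x' - kingHPot L (L ^ k) U a m2 k w b (underPtN L k 1 U x')|
      = f x' * Real.exp (-(δ' * tdistT U (blockOf (L ^ 1 * L ^ k) U x') b)) := by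
        rw [hfdef, hwtdef]; dsimp only
        rw [mul_assoc, ← Real.exp_add, add_neg_cancel, Real.exp_zero, mul_one]
    _ ≤ 2 * (D0 + RW * (w₀ * H') + CW * (ν * H')) * Real.exp (-(δ' * tdistT U (blockOf (L ^ 1 * L ^ k) U x') b)) :=
        mul_le_mul_of_nonneg_right hf (Real.exp_pos _).le

end StepDecay

/-! ## §3 The two-spacing difference of the full perturbation WITH DECAY in the unit sites -/

section PertDecay

variable (L : ℕ) [NeZero L] {U : Fin (d + 1) → ℕ} [∀ μ, NeZero (U μ)] {a m2 : ℝ}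

/-- **THE TWO-SPACING DIFFERENCE OF THE FULL PERTURBATION WITH DECAY**: two runs as in §2 with DECAYING letters at the common rate `δ > 0` for the
undressed minimiser (`c_H`, step `D₁`), the dressed size (`H′`, §1) and the dressed step (`S_d`, §2), sizes `w₀`, coherence `ν`:
`|E′(w′)(b, b′) − E(w)(b, b′)| ≤ (D₁(w₀H′) + c_H(νH′ + w₀S_d))·K_{d+1}(δ∕2)·e^{−(δ∕2)|b − b′|}` — part 8a's two-centre block sum on the exact Riemann
sums of part 10b. [cite: King1986, (2.13)–(2.15) p.653, Theorem 3.3 (3.7) p.658, Prop. 3.8 (3.71) p.664, (4.39)–(4.41) p.675] -/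
theorem effLaplacianPot_sub_step_decay {k : ℕ} (hak : 0 ≤ aK a L k) (hak' : 0 ≤ aK a L (k + 1)) (hm : 0 < m2)
    {w : Tor (fine (L ^ k) U) → ℝ} {w' : Tor (fine (L ^ 1 * L ^ k) U) → ℝ}
    (hB : IsUnit (fineOpPot (L ^ k) U (aK a L k) (((L ^ k : ℕ) : ℝ) ^ 2) m2 w))
    (hB' : IsUnit (fineOpPot (L ^ 1 * L ^ k) U (aK a L (k + 1)) (((L ^ 1 * L ^ k : ℕ) : ℝ) ^ 2) m2 w'))
    {cH D1 δ w₀ ν H' Sd : ℝ} (hcH : 0 ≤ cH) (hD1 : 0 ≤ D1) (hδ : 0 < δ) (hH'0 : 0 ≤ H') (hSd : 0 ≤ Sd)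
    (hHdec : ∀ (b : Tor U) (x : Tor (fine (L ^ k) U)),
      |kingH L (L ^ k) U a m2 k b x| ≤ cH * Real.exp (-(δ * tdistT U (blockOf (L ^ k) U x) b)))
    (hstep : ∀ (b : Tor U) (x' : Tor (fine (L ^ 1 * L ^ k) U)),
      |kingH L (L ^ 1 * L ^ k) U a m2 (k + 1) b x' - kingH L (L ^ k) U a m2 k b (underPtN L k 1 U x')|
        ≤ D1 * Real.exp (-(δ * tdistT U (blockOf (L ^ 1 * L ^ k) U x') b)))
    (hw : ∀ y, |w y| ≤ w₀) (hw' : ∀ y', |w' y'| ≤ w₀) (hcoh : ∀ y', |w' y' - w (underPtN L k 1 U y')| ≤ ν)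
    (hH' : ∀ (b : Tor U) (y' : Tor (fine (L ^ 1 * L ^ k) U)),
      |kingHPot L (L ^ 1 * L ^ k) U a m2 (k + 1) w' b y'| ≤ H' * Real.exp (-(δ * tdistT U (blockOf (L ^ 1 * L ^ k) U y') b)))
    (hd : ∀ (b : Tor U) (y' : Tor (fine (L ^ 1 * L ^ k) U)),
      |kingHPot L (L ^ 1 * L ^ k) U a m2 (k + 1) w' b y' - kingHPot L (L ^ k) U a m2 k w b (underPtN L k 1 U y')|
        ≤ Sd * Real.exp (-(δ * tdistT U (blockOf (L ^ 1 * L ^ k) U y') b)))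
    (b b' : Tor U) :
    |(effLaplacianPot (L ^ 1 * L ^ k) U (aK a L (k + 1)) (((L ^ 1 * L ^ k : ℕ) : ℝ) ^ 2) m2 w'
          - effLaplacian (L ^ 1 * L ^ k) U (aK a L (k + 1)) (((L ^ 1 * L ^ k : ℕ) : ℝ) ^ 2) m2) b b'
        - (effLaplacianPot (L ^ k) U (aK a L k) (((L ^ k : ℕ) : ℝ) ^ 2) m2 w
          - effLaplacian (L ^ k) U (aK a L k) (((L ^ k : ℕ) : ℝ) ^ 2) m2) b b'|
      ≤ (D1 * (w₀ * H') + cH * (ν * H' + w₀ * Sd)) * latticeConst (d + 1) (δ / 2) * Real.exp (-(δ / 2 * tdistT U b b')) := by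
  have hw₀ : 0 ≤ w₀ := nonneg_of_abs_le hw
  have hν : 0 ≤ ν := (abs_nonneg _).trans (hcoh fun _ => 0)
  rw [effLaplacianPot_sub_apply (L := L) hak' hm hB' b b', effLaplacianPot_sub_apply (L := L) hak hm hB b b',
    ← avg_comp_underPtN L U k (fun x => kingH L (L ^ k) U a m2 k b x * w x * kingHPot L (L ^ k) U a m2 k w b' x),
    ← mul_sub, ← sum_sub_distrib]
  have hpt : ∀ x' : Tor (fine (L ^ 1 * L ^ k) U),
      |kingH L (L ^ 1 * L ^ k) U a m2 (k + 1) b x' * w' x' * kingHPot L (L ^ 1 * L ^ k) U a m2 (k + 1) w' b' x'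
          - kingH L (L ^ k) U a m2 k b (underPtN L k 1 U x') * w (underPtN L k 1 U x')
              * kingHPot L (L ^ k) U a m2 k w b' (underPtN L k 1 U x')|
        ≤ (D1 * (w₀ * H') + cH * (ν * H' + w₀ * Sd)) * (Real.exp (-(δ * tdistT U (blockOf (L ^ 1 * L ^ k) U x') b))
            * Real.exp (-(δ * tdistT U (blockOf (L ^ 1 * L ^ k) U x') b'))) := by
    intro x'
    set eb := Real.exp (-(δ * tdistT U (blockOf (L ^ 1 * L ^ k) U x') b)) with heb
    set eb' := Real.exp (-(δ * tdistT U (blockOf (L ^ 1 * L ^ k) U x') b')) with heb'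
    have heb0 : 0 ≤ eb := (Real.exp_pos _).le
    have heb0' : 0 ≤ eb' := (Real.exp_pos _).le
    have hf : |kingH L (L ^ k) U a m2 k b (underPtN L k 1 U x')| ≤ cH * eb := by
      have h := hHdec b (underPtN L k 1 U x'); rwa [blockOf_underPtN] at h
    have htel := abs_kernel3_sub_le (kingH L (L ^ k) U a m2 k b (underPtN L k 1 U x')) (kingH L (L ^ 1 * L ^ k) U a m2 (k + 1) b x')
      (w (underPtN L k 1 U x')) (w' x') (kingHPot L (L ^ k) U a m2 k w b' (underPtN L k 1 U x'))
      (kingHPot L (L ^ 1 * L ^ k) U a m2 (k + 1) w' b' x')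
    refine htel.trans ?_
    calc |kingH L (L ^ 1 * L ^ k) U a m2 (k + 1) b x' - kingH L (L ^ k) U a m2 k b (underPtN L k 1 U x')| * |w' x'|
            * |kingHPot L (L ^ 1 * L ^ k) U a m2 (k + 1) w' b' x'|
          + |kingH L (L ^ k) U a m2 k b (underPtN L k 1 U x')|
            * (|w' x' - w (underPtN L k 1 U x')| * |kingHPot L (L ^ 1 * L ^ k) U a m2 (k + 1) w' b' x'|
              + |w (underPtN L k 1 U x')|
                * |kingHPot L (L ^ 1 * L ^ k) U a m2 (k + 1) w' b' x' - kingHPot L (L ^ k) U a m2 k w b' (underPtN L k 1 U x')|)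
        ≤ (D1 * eb) * w₀ * (H' * eb') + (cH * eb) * (ν * (H' * eb') + w₀ * (Sd * eb')) := by
          refine add_le_add ?_ ?_
          · exact mul_le_mul (mul_le_mul (hstep b x') (hw' x') (abs_nonneg _) (by positivity)) (hH' b' x') (abs_nonneg _)
              (by positivity)
          · refine mul_le_mul hf (add_le_add ?_ ?_) (by positivity) (by positivity)
            · exact mul_le_mul (hcoh x') (hH' b' x') (abs_nonneg _) hν
            · exact mul_le_mul (hw _) (hd b' x') (abs_nonneg _) hw₀
      _ = (D1 * (w₀ * H') + cH * (ν * H' + w₀ * Sd)) * (eb * eb') := by ring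
  calc _ ≤ ∑ z : Tor U, (D1 * (w₀ * H') + cH * (ν * H' + w₀ * Sd))
          * (Real.exp (-(δ * tdistT U z b)) * Real.exp (-(δ * tdistT U z b'))) :=
        abs_avg_sum_le_sum_blocks (L ^ 1 * L ^ k) U
          (G := fun z => (D1 * (w₀ * H') + cH * (ν * H' + w₀ * Sd)) * (Real.exp (-(δ * tdistT U z b)) * Real.exp (-(δ * tdistT U z b')))) hpt
    _ = (D1 * (w₀ * H') + cH * (ν * H' + w₀ * Sd)) * ∑ z : Tor U, Real.exp (-(δ * tdistT U z b)) * Real.exp (-(δ * tdistT U z b')) := by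
        rw [mul_sum]
    _ ≤ (D1 * (w₀ * H') + cH * (ν * H' + w₀ * Sd)) * (latticeConst (d + 1) (δ / 2) * Real.exp (-(δ / 2 * tdistT U b b'))) :=
        mul_le_mul_of_nonneg_left (sum_exp_two_centre_le hδ b b') (by positivity)
    _ = _ := by ring

end PertDecay

end Summit.QuantumFields.YangMills.BalabanUVNodes.N15.KingModel

end
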